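import Mathlib.Analysis.SpecialFunctions.Log.Base
import Mathlib.Analysis.SpecialFunctions.Pow.Real
import Mathlib.Data.Nat.Log
import Literature.Computability.AlgebraicComplexity.RectangularExponent
import Literature.Computability.AlgebraicComplexity.TensorMultiples
import HarnessLib

/-!
# Bounds for the rectangular exponents `ω(1, 1, q)`: `ω(1,1,q) ≥ 2`, one format, many copies, continuity, symmetry — proved

Topic `Literature/Computability/AlgebraicComplexity`. Infrastructure for the rectangular matrix
multiplication exponents `omegaRect K a b c = ω(a, b, c)` of `RectangularExponent.lean`
(`ω(1,1,q) = inf {β | R(⟨n, n, ⌈n^q⌉⟩) = O(n^β)}`, rank form), in the generality needed by the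
barrier catalogue entry `Literature/Barriers/MatrixMultiplication/RectangularBarrier.lean`
(soundness of `T`-methods, CLLZ Thm. 2.1). Everything here is PROVED, from the tree's Bläser
§5–§7 layer (`KroneckerRank.lean`, `FlatteningBound.lean`, `TensorMultiples.lean`,
`TensorRankFactsProofs.lean`); no named facts.

## Content

* `tensorRank_matMulTensor_mono₃` — padding in all three dimensions (Bläser 2013, Lemma 5.4);
  `tensorRank_matMulTensor_pow_le₃` — `R(⟨kⁱ,mⁱ,nⁱ⟩) ≤ R(⟨k,m,n⟩)ⁱ` (Lemma 5.8, p. 24).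
* `two_le_of_mem_rectAdmissibleExponents_one_one`, `rectAdmissibleExponents_one_one_bddBelow`,
  `two_le_omegaRect_one_one` — flattening `R(⟨n,n,⌈n^q⌉⟩) ≥ n²` gives `β ≥ 2` for every admissible
  `β`, so `ω(1,1,q) ≥ 2` and the defining infimum is genuine (Bläser 2013, Lemma 7.1 (2)).
* `logb_mem_rectAdmissibleExponents_one_one`, `omegaRect_one_one_le_logb` — the rectangular form of
  Bläser 2013, Thm. 5.9: `R(⟨A, A, A'⟩) ≤ ρ` with `A ≥ 2`, `A' ≥ A^q` gives `ω(1,1,q) ≤ log_A ρ`.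
* `rpow_omegaRect_le_of_tensorRank_multiple_le` — the rectangular form of Bläser 2013, Lemma 7.7
  (the equal-summand case of Schönhage's asymptotic sum inequality): `R(f ⊙ ⟨a,a,b⟩) ≤ Q f`,
  `b ≥ a^q` gives `a^{ω(1,1,q)} ≤ Q`.
* `add_mem_rectAdmissibleExponents_one_one`, `omegaRect_one_one_le_add` — the Lipschitz estimate
  `ω(1,1,p) ≤ ω(1,1,q) + (p − q)` for `q ≤ p` (continuity of `p ↦ ω(p)`, Lotti–Romani 1983, as
  invoked in CLLZ Rem. 3.13).
* `rectAdmissibleExponents_one_mid_one`, `omegaRect_one_mid_one` — `ω(1, p, 1) = ω(1, 1, p)`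
  (Bläser 2013, Lemma 5.5; Le Gall 2012, §1).

## References

* M. Bläser, *Fast Matrix Multiplication*, Theory of Computing Graduate Surveys 5 (2013), Lemma 5.4,
  Lemma 5.5, Lemma 5.8 and p. 24, Thm. 5.9, Lemma 7.1, Lemma 7.7. [Blaser2013]
* M. Christandl, F. Le Gall, V. Lysikov, J. Zuiddam, *Barriers for rectangular matrix
  multiplication*, comput. complexity 34 (2025), Thm. 2.1, Rem. 3.13 (arXiv:2003.03019).
  [ChristandlLeGallLysikovZuiddam2025]
* F. Le Gall, *Faster algorithms for rectangular matrix multiplication*, FOCS 2012, §1–§2. [LeGall2012]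

## Design notes

* `ω`-statements are over `K : Type` (universe `0`), as in `TensorMultiples.lean`.
* Only the last-slot exponents `ω(1,1,q)` are developed; the middle slot is reached through
  `omegaRect_one_mid_one`. Exponents `q < 0` are allowed where harmless (`⌈n^q⌉ = 1` for `n ≥ 2`).
-/

noncomputable section

open scoped BigOperators
open Filter Asymptotics

namespace Literature.Computability.AlgebraicComplexity

universe u

/-! ## Matrix multiplication tensors: padding in three dimensions, powers -/

section MatMul

variable (K : Type u) [CommSemiring K]

/-- **Zero-padding in all three dimensions**: `R(⟨k,m,n⟩) ≤ R(⟨k',m',n'⟩)` for `k ≤ k'`, `m ≤ m'`,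
`n ≤ n'` (`⟨k,m,n⟩` is the restriction of `⟨k',m',n'⟩` along the coordinate embeddings
`Fin.castLE`; Bläser 2013, Lemma 5.4 / Def. 7.2). [cite: Blaser2013, Lemma 5.4] -/
theorem tensorRank_matMulTensor_mono₃ {k k' m m' n n' : ℕ} (hk : k ≤ k') (hm : m ≤ m')
    (hn : n ≤ n') : tensorRank (matMulTensor K k m n) ≤ tensorRank (matMulTensor K k' m' n') := by
  have e : matMulTensor K k m n = fun a b c => matMulTensor K k' m' n'
      (Prod.map (Fin.castLE hk) (Fin.castLE hn) a) (Prod.map (Fin.castLE hk) (Fin.castLE hm) b)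
      (Prod.map (Fin.castLE hm) (Fin.castLE hn) c) := by
    funext a b c
    simp [matMulTensor, Prod.map, Fin.ext_iff]
  rw [e]
  exact tensorRank_precomp_le _ _ _ _

/-- **`R(⟨kⁱ, mⁱ, nⁱ⟩) ≤ R(⟨k,m,n⟩)ⁱ`** (Bläser 2013, Lemma 5.8 with p. 24, iterated: the `i`-th
Kronecker power of `⟨k,m,n⟩` is `⟨kⁱ,mⁱ,nⁱ⟩`). [cite: Blaser2013, Lemma 5.8 and p. 24] -/
theorem tensorRank_matMulTensor_pow_le₃ (k m n i : ℕ) :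
    tensorRank (matMulTensor K (k ^ i) (m ^ i) (n ^ i)) ≤ tensorRank (matMulTensor K k m n) ^ i := by
  induction i with
  | zero => simpa using tensorRank_matMulTensor_le K 1 1 1
  | succ i ih =>
    rw [pow_succ, pow_succ, pow_succ, pow_succ]
    exact (Blaser2013_rank_matMulTensor_mul_le K (k ^ i) (m ^ i) (n ^ i) k m n).trans
      (Nat.mul_le_mul_right _ ih)

end MatMul

/-! ## The rectangular exponents `ω(1, 1, q)`: lower bound, one-format bound, copies, continuity -/

section OmegaRect

variable (K : Type) [Field K]

/-- Every admissible exponent of `(1, 1, q)`-rectangular matrix multiplication is `≥ 2`: by the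
flattening bound `R(⟨n, n, ⌈n^q⌉⟩) ≥ n²` (Bläser 2013, Lemma 7.1 (2)), `R = O(n^β)` forces `β ≥ 2`.
[cite: Blaser2013, Lemma 7.1 (2)] -/
theorem two_le_of_mem_rectAdmissibleExponents_one_one {q β : ℝ}
    (hβ : β ∈ rectAdmissibleExponents K 1 1 q) : 2 ≤ β := by
  by_contra hlt
  rw [not_le] at hlt
  obtain ⟨C, hC⟩ := isBigO_iff.1 hβ
  -- eventually `n ^ (2 - β) ≤ C`
  have hev : ∀ᶠ n : ℕ in atTop, (n : ℝ) ^ (2 - β) ≤ C := by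
    filter_upwards [hC, eventually_gt_atTop 0] with n hn hn0
    have hn0' : (0 : ℝ) < n := Nat.cast_pos.2 hn0
    rw [Real.norm_of_nonneg (Nat.cast_nonneg _),
      Real.norm_of_nonneg (Real.rpow_nonneg (Nat.cast_nonneg _) _)] at hn
    have hflat : n * n ≤ tensorRank (matMulTensor K (rectDim n 1) (rectDim n 1) (rectDim n q)) := by
      haveI : NeZero (rectDim n q) := ⟨Nat.one_le_iff_ne_zero.1 (one_le_rectDim hn0 q)⟩
      rw [tensorRank_matMulTensor_congr K (rectDim_one n) (rectDim_one n) rfl]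
      exact mul_le_tensorRank_matMulTensor_left K n n (rectDim n q)
    have hsq : (n : ℝ) ^ (2 : ℝ) ≤ C * (n : ℝ) ^ β := by
      refine le_trans ?_ hn
      rw [Real.rpow_two, sq]
      exact_mod_cast hflat
    rw [Real.rpow_sub hn0', div_le_iff₀ (Real.rpow_pos_of_pos hn0' _)]
    exact hsq
  -- but `n ^ (2 - β) → ∞`
  have hlim : Tendsto (fun n : ℕ => (n : ℝ) ^ (2 - β)) atTop atTop :=
    (tendsto_rpow_atTop (by linarith)).comp tendsto_natCast_atTop_atTop
  obtain ⟨n, hn₁, hn₂⟩ := (hev.and (hlim.eventually_gt_atTop C)).exists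
  exact absurd hn₁ (not_le.2 hn₂)

/-- The admissible exponents of `(1, 1, q)` are bounded below (by `2`), so `ω(1,1,q) = inf …` is a
genuine infimum. [cite: Blaser2013, Lemma 7.1 (2)] -/
theorem rectAdmissibleExponents_one_one_bddBelow (q : ℝ) :
    BddBelow (rectAdmissibleExponents K 1 1 q) :=
  ⟨2, fun _ hβ => two_le_of_mem_rectAdmissibleExponents_one_one K hβ⟩

/-- **`ω(1, 1, q) ≥ 2`** for every field and every real `q` (flattening). [cite: Blaser2013, Lemma 7.1 (2)] -/
theorem two_le_omegaRect_one_one (q : ℝ) : 2 ≤ omegaRect K 1 1 q :=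
  le_csInf (rectAdmissibleExponents_nonempty K 1 1 q)
    fun _ hβ => two_le_of_mem_rectAdmissibleExponents_one_one K hβ

/-- **From one rectangular format to an admissible exponent** (the interpolation step of
Bläser 2013, Thm. 5.9, in the rectangular setting of Le Gall 2012 §2 / CLLZ Thm. 2.1): if
`R(⟨A, A, A'⟩) ≤ ρ` with `A ≥ 2`, `A' ≥ A^q` (`q ≥ 0`), `ρ ≥ 1`, then `log_A ρ` is an admissible
exponent of `(1,1,q)`, indeed `R(⟨n, n, ⌈n^q⌉⟩) ≤ ρ · n^{log_A ρ}` for all `n ≥ 1` (choose `S` with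
`A^{S-1} ≤ n < A^S`; then `⌈n^q⌉ ≤ A'^S` and `R(⟨n,n,⌈n^q⌉⟩) ≤ R(⟨A^S, A^S, A'^S⟩) ≤ ρ^S ≤ ρ n^{log_A ρ}`).
[cite: Blaser2013, Thm. 5.9 (proof, p. 24)] -/
theorem logb_mem_rectAdmissibleExponents_one_one {q : ℝ} (hq : 0 ≤ q) {A A' ρ : ℕ} (hA : 1 < A)
    (hA' : (A : ℝ) ^ q ≤ A') (hρ : 1 ≤ ρ) (h : tensorRank (matMulTensor K A A A') ≤ ρ) :
    Real.logb A ρ ∈ rectAdmissibleExponents K 1 1 q := by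
  set β : ℝ := Real.logb A ρ with hβ
  have hA0 : (0 : ℝ) < A := by exact_mod_cast (zero_lt_one.trans hA)
  have hA1 : (1 : ℝ) < A := by exact_mod_cast hA
  have hρ0 : (0 : ℝ) < ρ := by exact_mod_cast hρ
  have hβ0 : 0 ≤ β := Real.logb_nonneg hA1 (by exact_mod_cast hρ)
  have hAβ : (A : ℝ) ^ β = ρ := Real.rpow_logb hA0 hA1.ne' hρ0
  refine IsBigO.of_bound (ρ : ℝ) ?_
  filter_upwards [eventually_ge_atTop 1] with n hn
  set S := Nat.log A n + 1 with hS
  have hlt : n < A ^ S := Nat.lt_pow_succ_log_self hA n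
  have hle : A ^ S ≤ A * n := by
    rw [hS, pow_succ, mul_comm]
    exact Nat.mul_le_mul_left A (Nat.pow_log_le_self A (by omega))
  -- the rectangular dimension fits: `⌈n^q⌉ ≤ A'^S`
  have hdim : rectDim n q ≤ A' ^ S := by
    show ⌈(n : ℝ) ^ q⌉₊ ≤ A' ^ S
    refine Nat.ceil_le.2 ?_
    have h1 : (n : ℝ) ^ q ≤ ((A ^ S : ℕ) : ℝ) ^ q :=
      Real.rpow_le_rpow (Nat.cast_nonneg _) (by exact_mod_cast hlt.le) hq
    have e : ((A : ℝ) ^ S) ^ q = ((A : ℝ) ^ q) ^ S := by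
      rw [← Real.rpow_natCast_mul hA0.le, mul_comm, Real.rpow_mul_natCast hA0.le]
    refine h1.trans ?_
    rw [Nat.cast_pow, Nat.cast_pow, e]
    exact pow_le_pow_left₀ (Real.rpow_nonneg hA0.le q) hA' S
  have hnat : tensorRank (matMulTensor K (rectDim n 1) (rectDim n 1) (rectDim n q)) ≤ ρ ^ S := by
    rw [tensorRank_matMulTensor_congr K (rectDim_one n) (rectDim_one n) rfl]
    calc tensorRank (matMulTensor K n n (rectDim n q))
        ≤ tensorRank (matMulTensor K (A ^ S) (A ^ S) (A' ^ S)) :=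
          tensorRank_matMulTensor_mono₃ K hlt.le hlt.le hdim
      _ ≤ tensorRank (matMulTensor K A A A') ^ S := tensorRank_matMulTensor_pow_le₃ K A A A' S
      _ ≤ ρ ^ S := Nat.pow_le_pow_left h S
  have hn0 : (0 : ℝ) ≤ n := Nat.cast_nonneg _
  rw [Real.norm_of_nonneg (Nat.cast_nonneg _), Real.norm_of_nonneg (Real.rpow_nonneg hn0 _)]
  calc (tensorRank (matMulTensor K (rectDim n 1) (rectDim n 1) (rectDim n q)) : ℝ)
      ≤ (ρ : ℝ) ^ S := by exact_mod_cast hnat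
    _ = ((A ^ S : ℕ) : ℝ) ^ β := by
      rw [Nat.cast_pow, ← hAβ, ← Real.rpow_mul_natCast hA0.le, ← Real.rpow_natCast_mul hA0.le]
      congr 1
      exact mul_comm _ _
    _ ≤ ((A * n : ℕ) : ℝ) ^ β :=
      Real.rpow_le_rpow (Nat.cast_nonneg _) (by exact_mod_cast hle) hβ0
    _ = ρ * (n : ℝ) ^ β := by rw [Nat.cast_mul, Real.mul_rpow hA0.le hn0, hAβ]

/-- **`ω(1,1,q) ≤ log_A ρ` whenever `R(⟨A, A, A'⟩) ≤ ρ`** (`A ≥ 2`, `A' ≥ A^q`, `q ≥ 0`, `ρ ≥ 1`): the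
rectangular form of Bläser 2013, Thm. 5.9 (`R(⟨n,n,n⟩) ≤ r ⇒ ω ≤ log_n r`).
[cite: Blaser2013, Thm. 5.9] -/
theorem omegaRect_one_one_le_logb {q : ℝ} (hq : 0 ≤ q) {A A' ρ : ℕ} (hA : 1 < A)
    (hA' : (A : ℝ) ^ q ≤ A') (hρ : 1 ≤ ρ) (h : tensorRank (matMulTensor K A A A') ≤ ρ) :
    omegaRect K 1 1 q ≤ Real.logb A ρ :=
  csInf_le (rectAdmissibleExponents_one_one_bddBelow K q)
    (logb_mem_rectAdmissibleExponents_one_one K hq hA hA' hρ h)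

/-- **Bläser's Lemma 7.7 in rectangular form (equal-summand asymptotic sum inequality for
`ω(1,1,q)`, multiplicative form)**: if `R(f ⊙ ⟨a, a, b⟩) ≤ Q · f` with `f ≥ 1`, `a ≥ 2` and
`b ≥ a^q` (`q ≥ 0`), then `a^{ω(1,1,q)} ≤ Q`.  Proof as for Bläser 2013, Lemma 7.7: the claim
`R(f ⊙ ⟨aˢ, aˢ, bˢ⟩) ≤ Qˢ f` (`Blaser2013_lemma77_claim`), the one-format bound
`ω(1,1,q) ≤ (s log Q + log f)/(s log a)` (`omegaRect_one_one_le_logb`, as `bˢ ≥ (aˢ)^q`), and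
`s → ∞`. This is the form in which Schönhage's asymptotic sum inequality enters CLLZ Thm. 2.1.
[cite: Blaser2013, Lemma 7.7] -/
theorem rpow_omegaRect_le_of_tensorRank_multiple_le {q : ℝ} (hq : 0 ≤ q) {f Q a b : ℕ}
    (hf : 1 ≤ f) (ha : 2 ≤ a) (hab : (a : ℝ) ^ q ≤ b)
    (h : tensorRank (kroneckerTensor (unitTensor K f) (matMulTensor K a a b)) ≤ Q * f) :
    (a : ℝ) ^ omegaRect K 1 1 q ≤ Q := by
  have ha0 : (0 : ℝ) < a := by exact_mod_cast (by omega : 0 < a)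
  have ha1 : (1 : ℝ) ≤ a := by exact_mod_cast (by omega : 1 ≤ a)
  have hb : 1 ≤ b := by
    have h1 : (1 : ℝ) ≤ (a : ℝ) ^ q := Real.one_le_rpow ha1 hq
    exact_mod_cast h1.trans hab
  haveI : NeZero b := ⟨by omega⟩
  -- `Q ≥ 1`: `1 ≤ a·a ≤ R(⟨a,a,b⟩) ≤ R(f ⊙ ⟨a,a,b⟩) ≤ Q f`
  have hQ : 1 ≤ Q := by
    have h1 : 1 ≤ Q * f :=
      calc 1 ≤ a * a := by nlinarith
        _ ≤ tensorRank (matMulTensor K a a b) := mul_le_tensorRank_matMulTensor_left K a a b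
        _ ≤ tensorRank (kroneckerTensor (unitTensor K f) (matMulTensor K a a b)) :=
          tensorRank_le_tensorRank_multiple hf _
        _ ≤ Q * f := h
    rcases Nat.eq_zero_or_pos Q with hQ0 | hQ0
    · subst hQ0; simp at h1
    · exact hQ0
  -- rank bounds for all powers
  have hR : ∀ s : ℕ, tensorRank (matMulTensor K (a ^ (s + 1)) (a ^ (s + 1)) (b ^ (s + 1))) ≤
      Q ^ (s + 1) * f := by
    intro s
    calc tensorRank (matMulTensor K (a ^ (s + 1)) (a ^ (s + 1)) (b ^ (s + 1)))
        ≤ tensorRank (kroneckerTensor (unitTensor K f)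
            (matMulTensor K (a ^ (s + 1)) (a ^ (s + 1)) (b ^ (s + 1)))) :=
          tensorRank_le_tensorRank_multiple hf _
      _ ≤ Q ^ s * (Q * f) := Blaser2013_lemma77_claim K h s
      _ = Q ^ (s + 1) * f := by ring
  -- the one-format bound for each power
  set L : ℝ := Real.log (a : ℝ) with hL
  have hLpos : 0 < L := Real.log_pos (by exact_mod_cast (by omega : 1 < a))
  have hQ0 : (0 : ℝ) < Q := by exact_mod_cast hQ
  have hf0 : (0 : ℝ) < f := by exact_mod_cast hf
  have key : ∀ s : ℕ, omegaRect K 1 1 q ≤ Real.log Q / L + Real.log f / L / ((s : ℝ) + 1) := by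
    intro s
    have hpow : 1 < a ^ (s + 1) := Nat.one_lt_pow (Nat.succ_ne_zero s) (by omega : 1 < a)
    have hdim : ((a ^ (s + 1) : ℕ) : ℝ) ^ q ≤ ((b ^ (s + 1) : ℕ) : ℝ) := by
      rw [Nat.cast_pow, Nat.cast_pow, ← Real.rpow_natCast_mul ha0.le, mul_comm,
        Real.rpow_mul_natCast ha0.le]
      exact pow_le_pow_left₀ (Real.rpow_nonneg ha0.le q) hab (s + 1)
    have hρ : 1 ≤ Q ^ (s + 1) * f := Nat.one_le_iff_ne_zero.2
      (Nat.mul_ne_zero (pow_ne_zero _ (by omega)) (by omega))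
    have hA := omegaRect_one_one_le_logb K hq hpow hdim hρ (hR s)
    have e1 : (((a ^ (s + 1) : ℕ)) : ℝ) = (a : ℝ) ^ (s + 1) := by push_cast; ring
    have e2 : Real.log (((Q ^ (s + 1) * f : ℕ) : ℝ)) = ((s : ℝ) + 1) * Real.log Q + Real.log f := by
      push_cast
      rw [Real.log_mul (by positivity) hf0.ne', Real.log_pow]
      push_cast
      ring
    rw [e1, Real.logb, Real.log_pow, e2] at hA
    refine hA.trans_eq ?_
    rw [← hL]
    push_cast
    field_simp
  -- `s → ∞`
  have hA : omegaRect K 1 1 q ≤ Real.log Q / L := by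
    refine le_of_forall_pos_lt_add fun ε hε => ?_
    obtain ⟨s, hs⟩ := exists_nat_gt (Real.log f / L / ε)
    have hs1 : Real.log f / L / ((s : ℝ) + 1) < ε := by
      rw [div_lt_iff₀ (by positivity)]
      rw [div_lt_iff₀ hε] at hs
      nlinarith
    linarith [key s]
  have hmul : omegaRect K 1 1 q * L ≤ Real.log Q := (le_div_iff₀ hLpos).1 hA
  calc (a : ℝ) ^ omegaRect K 1 1 q = Real.exp (L * omegaRect K 1 1 q) := Real.rpow_def_of_pos ha0 _
    _ ≤ Real.exp (Real.log Q) := Real.exp_le_exp.2 (by rw [mul_comm]; exact hmul)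
    _ = Q := Real.exp_log hQ0

/-- `⌈n^p⌉ ≤ ⌈n^q⌉ · ⌈n^{p-q}⌉` for `n ≥ 1`. [folklore] -/
theorem rectDim_le_rectDim_mul_rectDim {n : ℕ} (hn : 1 ≤ n) (p q : ℝ) :
    rectDim n p ≤ rectDim n q * rectDim n (p - q) := by
  have hn' : (0 : ℝ) < n := by exact_mod_cast hn
  show ⌈(n : ℝ) ^ p⌉₊ ≤ rectDim n q * rectDim n (p - q)
  refine Nat.ceil_le.2 ?_
  calc (n : ℝ) ^ p = (n : ℝ) ^ q * (n : ℝ) ^ (p - q) := by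
        rw [← Real.rpow_add hn', add_sub_cancel]
    _ ≤ (rectDim n q : ℝ) * (rectDim n (p - q) : ℝ) :=
        mul_le_mul (Nat.le_ceil _) (Nat.le_ceil _) (Real.rpow_nonneg hn'.le _) (Nat.cast_nonneg _)
    _ = ((rectDim n q * rectDim n (p - q) : ℕ) : ℝ) := by push_cast; rfl

/-- **Admissible exponents shift with the rectangular exponent**: if `β` is admissible for
`(1, 1, q)` and `q ≤ p` then `β + (p − q)` is admissible for `(1, 1, p)`, because
`R(⟨n, n, ⌈n^p⌉⟩) ≤ R(⟨n, n, ⌈n^q⌉⌈n^{p-q}⌉⟩) ≤ R(⟨n, n, ⌈n^q⌉⟩) · ⌈n^{p-q}⌉ ≤ 2 C n^{β + (p-q)}`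
(padding, `⟨n,n,de⟩ ≅ ⟨n,n,d⟩ ⊗ ⟨1,1,e⟩` and `R(⟨1,1,e⟩) ≤ e`). This is the elementary Lipschitz
estimate behind the continuity of `p ↦ ω(p)` (Lotti–Romani 1983) used in CLLZ, Rem. 3.13.
[cite: ChristandlLeGallLysikovZuiddam2025, Rem. 3.13] -/
theorem add_mem_rectAdmissibleExponents_one_one {p q β : ℝ} (hqp : q ≤ p)
    (hβ : β ∈ rectAdmissibleExponents K 1 1 q) :
    β + (p - q) ∈ rectAdmissibleExponents K 1 1 p := by
  obtain ⟨C, hC0, hC⟩ := hβ.exists_nonneg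
  refine IsBigO.of_bound (2 * C) ?_
  filter_upwards [hC.bound, eventually_ge_atTop 1] with n hCn hn
  have hn0 : (0 : ℝ) < n := by exact_mod_cast hn
  rw [Real.norm_of_nonneg (Nat.cast_nonneg _), Real.norm_of_nonneg (Real.rpow_nonneg hn0.le _)]
    at hCn ⊢
  rw [tensorRank_matMulTensor_congr K (rectDim_one n) (rectDim_one n) rfl] at hCn ⊢
  have h1 : tensorRank (matMulTensor K n n (rectDim n p)) ≤
      tensorRank (matMulTensor K n n (rectDim n q)) * rectDim n (p - q) := by
    calc tensorRank (matMulTensor K n n (rectDim n p))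
        ≤ tensorRank (matMulTensor K (n * 1) (n * 1) (rectDim n q * rectDim n (p - q))) := by
          rw [tensorRank_matMulTensor_congr K (Nat.mul_one n) (Nat.mul_one n) rfl]
          exact tensorRank_matMulTensor_mono₃ K le_rfl le_rfl (rectDim_le_rectDim_mul_rectDim hn p q)
      _ ≤ tensorRank (matMulTensor K n n (rectDim n q)) *
            tensorRank (matMulTensor K 1 1 (rectDim n (p - q))) :=
          Blaser2013_rank_matMulTensor_mul_le K n n (rectDim n q) 1 1 (rectDim n (p - q))
      _ ≤ tensorRank (matMulTensor K n n (rectDim n q)) * rectDim n (p - q) := by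
          refine Nat.mul_le_mul_left _ ?_
          simpa using tensorRank_matMulTensor_le K 1 1 (rectDim n (p - q))
  have hk : (rectDim n (p - q) : ℝ) ≤ 2 * (n : ℝ) ^ (p - q) := by
    simpa [max_eq_left (sub_nonneg.mpr hqp)] using rectDim_le hn (p - q)
  calc (tensorRank (matMulTensor K n n (rectDim n p)) : ℝ)
      ≤ (tensorRank (matMulTensor K n n (rectDim n q)) * rectDim n (p - q) : ℕ) := by
        exact_mod_cast h1
    _ = (tensorRank (matMulTensor K n n (rectDim n q)) : ℝ) * rectDim n (p - q) := by
        push_cast; ring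
    _ ≤ (C * (n : ℝ) ^ β) * (2 * (n : ℝ) ^ (p - q)) :=
        mul_le_mul hCn hk (Nat.cast_nonneg _) (by positivity)
    _ = 2 * C * (n : ℝ) ^ (β + (p - q)) := by
        rw [Real.rpow_add hn0]; ring

/-- **`ω(1,1,p) ≤ ω(1,1,q) + (p − q)` for `q ≤ p`** — `p ↦ ω(p)` is monotone-Lipschitz, in
particular continuous (Lotti–Romani 1983; the continuity invoked in CLLZ Rem. 3.13).
[cite: ChristandlLeGallLysikovZuiddam2025, Rem. 3.13] -/
theorem omegaRect_one_one_le_add {p q : ℝ} (hqp : q ≤ p) :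
    omegaRect K 1 1 p ≤ omegaRect K 1 1 q + (p - q) := by
  unfold omegaRect
  rw [← sub_le_iff_le_add]
  refine le_csInf (rectAdmissibleExponents_nonempty K 1 1 q) fun β hβ => ?_
  rw [sub_le_iff_le_add]
  exact csInf_le (rectAdmissibleExponents_one_one_bddBelow K p)
    (add_mem_rectAdmissibleExponents_one_one K hqp hβ)

/-- The admissible exponents of `(1, p, 1)` and `(1, 1, p)` coincide, since
`R(⟨n, ⌈n^p⌉, n⟩) = R(⟨n, n, ⌈n^p⌉⟩)` (Bläser 2013, Lemma 5.5: `R(⟨k,m,n⟩) = R(⟨k,n,m⟩)`; the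
"well known" symmetry `ω(1,1,k) = ω(1,k,1)` of Le Gall 2012, §1). [cite: Blaser2013, Lemma 5.5] -/
theorem rectAdmissibleExponents_one_mid_one (p : ℝ) :
    rectAdmissibleExponents K 1 p 1 = rectAdmissibleExponents K 1 1 p := by
  have hf : (fun n : ℕ =>
      (tensorRank (matMulTensor K (rectDim n 1) (rectDim n p) (rectDim n 1)) : ℝ)) =
      fun n : ℕ => (tensorRank (matMulTensor K (rectDim n 1) (rectDim n 1) (rectDim n p)) : ℝ) :=
    funext fun n => by
      rw [(Blaser2013_lemma55 K (rectDim n 1) (rectDim n p) (rectDim n 1)).2.2.2.2]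
  ext β
  simp only [rectAdmissibleExponents, Set.mem_setOf_eq, hf]

/-- **`ω(1, p, 1) = ω(1, 1, p)`** (Bläser 2013, Lemma 5.5; Le Gall 2012, §1: the middle and the last
placement of the rectangular dimension give the same exponent). [cite: Blaser2013, Lemma 5.5] -/
theorem omegaRect_one_mid_one (p : ℝ) : omegaRect K 1 p 1 = omegaRect K 1 1 p := by
  unfold omegaRect
  rw [rectAdmissibleExponents_one_mid_one]

end OmegaRect

end Literature.Computability.AlgebraicComplexity

end
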